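import Mathlib
import HarnessLib
import Literature.NumberTheory.GaloisRepresentations.AbsGaloisOuterConj
import Literature.NumberTheory.GaloisRepresentations.LocalKroneckerWeberInertiaProofs

/-!
# Stub `stub_cyclotomicOuterConj` (line `local_clause_cut`, crux `EmptyWeightCore`, stmt-Langlands-17008)

For a Galois number field `F/ℚ`, a prime `p`, `τ ∈ Γ_ℚ` and `g, x ∈ Γ_F`, the `p`-adic cyclotomic
character `ε_F = GaloisRep.cyclotomicCharacter F p : Γ_F →ₜ* ℤ_pˣ` is invariant under the outer
action `θ_τ = absGaloisOuterConj ℚ F τ` of `Γ_ℚ` on `Γ_F` composed with inner conjugation: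

  `ε_F (g⁻¹ · θ_τ(x) · g) = ε_F (x)`.

Proof.  `ℤ_pˣ` is commutative, so `ε_F (g⁻¹ y g) = ε_F(g)⁻¹ ε_F(y) ε_F(g) = ε_F(y)`
(`map_mul`, `map_inv`, `inv_mul_cancel_comm`).  The cyclotomic character is compatible with
restriction, `ε_F = ε_ℚ ∘ res` for `res = absGaloisRestrict ℚ F : Γ_F → Γ_ℚ`
(`cyclotomicCharacter_absGaloisRestrict`), and `res (θ_τ x) = τ · res x · τ⁻¹`
(`absGaloisRestrict_absGaloisOuterConj`), so
`ε_F (θ_τ x) = ε_ℚ (τ · res x · τ⁻¹) = ε_ℚ (res x) = ε_F (x)` (`mul_inv_cancel_comm`).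

Reference: Serre, *Abelian ℓ-adic representations and elliptic curves* (1968), Ch. I §1.2 (the
cyclotomic character `χ_ℓ : Gal(K̄/K) → ℤ_ℓˣ`, functorial in `K`).  No `sorry`, no new definitions.
-/

-- project-wide option (lakefile weak.linter.dupNamespace); `Summit.Langlands.Langlands` is mandated
set_option linter.dupNamespace false

noncomputable section

namespace Summit.Langlands.Langlands.Cruxes.EmptyWeightCore.LocalClauseCut

open Literature.NumberTheory.GaloisRepresentations Field IsDedekindDomain NumberField

/-- **The cyclotomic character is invariant under the outer action of `Γ_ℚ`**: for `F/ℚ` a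
Galois number field, `p` prime, `τ ∈ Γ_ℚ` and `g, x ∈ Γ_F`,
`ε_F (g⁻¹ · θ_τ(x) · g) = ε_F (x)`, where `ε_F = GaloisRep.cyclotomicCharacter F p` and
`θ_τ = absGaloisOuterConj ℚ F τ : σ ↦ res⁻¹(τ res(σ) τ⁻¹)` (`ε_F = ε_ℚ ∘ res`,
`cyclotomicCharacter_absGaloisRestrict`; `res (θ_τ x) = τ res(x) τ⁻¹`,
`absGaloisRestrict_absGaloisOuterConj`; `ℤ_pˣ` is commutative).
[cite: SerreAbelianLadic1968, Ch. I §1.2] -/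
theorem stub_cyclotomicOuterConj :
    ∀ (F : Type) [Field F] [NumberField F] [IsGalois ℚ F] (p : ℕ) [Fact p.Prime]
      (τ : absoluteGaloisGroup ℚ) (g x : absoluteGaloisGroup F),
      GaloisRep.cyclotomicCharacter F p (g⁻¹ * absGaloisOuterConj ℚ F τ x * g) =
        GaloisRep.cyclotomicCharacter F p x := by
  intro F _ _ _ p _ τ g x
  rw [map_mul, map_mul, map_inv, inv_mul_cancel_comm,
    ← cyclotomicCharacter_absGaloisRestrict ℚ F p (absGaloisOuterConj ℚ F τ x),
    absGaloisRestrict_absGaloisOuterConj, map_mul, map_mul, map_inv, mul_inv_cancel_comm,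
    cyclotomicCharacter_absGaloisRestrict]

end Summit.Langlands.Langlands.Cruxes.EmptyWeightCore.LocalClauseCut

end
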